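import Mathlib
import Literature.Combinatorics.Words.VanDerWaerdenCadences
import HarnessLib

/-!
# Rado's theorem for a single equation, with Schur's theorem

R. L. Graham, B. L. Rothschild, J. H. Spencer, *Ramsey Theory* (2nd ed., Wiley 1990)
[GrahamRothschildSpencer1990], Chapter 3 "Equations", §3.1 "Schur's theorem" (pp. 69–71) and
§3.2 "Regular homogeneous equations (Rado's theorem — abridged)" (pp. 71–73); originals
I. Schur, *Über die Kongruenz `x^m + y^m ≡ z^m (mod p)`*, Jahresber. DMV 25 (1916) 114–117
[Schur1916] and R. Rado, *Studien zur Kombinatorik*, Math. Z. 36 (1933) 424–480 [Rado1933].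

A system `S(x_1, …, x_n)` is *regular* on the positive integers if every finite colouring of them
admits `x_1, …, x_n` of one colour (not necessarily distinct) satisfying `S` (p. 71).  Colourings
are functions `χ : ℕ → κ` into a finite type; only their values at positive integers matter.

PROVED here (theorems only), following the printed proofs:

* `exists_mono_ap_with_multiple` — **Theorem 2** (p. 70): for all `k`, `s ≥ 1` and finitely many
  colours there is `n` such that every colouring has `a, d > 0`, `a + kd ≤ n`, `sd ≤ n` with
  `{a, a + d, …, a + kd} ∪ {sd}` monochromatic.  The printed induction on the number `r` of
  colours over van der Waerden's theorem (the tree's `Literature.Combinatorics.Words.vanDerWaerden`,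
  Lothaire's Theorem 3.1.3) is run on the set `T` of colours used
  (`exists_mono_ap_with_multiple_of_colours_subset`), with the printed bound `n = s·W(kL + 1)`
  (up to the shift by one coming from colouring `{0, …, W}` instead of `[W]`).
* `exists_mono_symmetric_ap_with_multiple` — **Corollary 3** (p. 71): the same with
  `{a + λd : |λ| ≤ k} ∪ {sd}`.
* `rado_of_subset_sum_eq_zero` — **Theorem 4, "if"** (p. 71), in finite form (a bound `N`
  depending on the coefficients and the number of colours, as the proof gives): nonzero integers
  `c_i` with a nonempty zero-sum subset `J` ⇒ `Σ c_i x_i = 0` has monochromatic positive solutions.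
  The printed parametric solution (5) `x_i = a + λ_i d (i ∈ J)`, `x_i = sd (i ∉ J)` is used with the
  particular choice `λ_{i₀} = −B c_{i₀}`, `λ_i = 0` otherwise, `s = c_{i₀}²` (`B = Σ_{i ∉ J} c_i`,
  `i₀ ∈ J`), which needs no Bézout coefficients; Corollary 3 makes it monochromatic.
* `no_mono_solution_smod_colouring` — **Theorem 4, "only if"** (pp. 71–73, the Claim): if no
  nonempty subset of the `c_i` sums to zero and the prime `p` exceeds `Σ |c_i|` (so divides no
  nonzero subset sum), the super-modulo-`p` colouring `F_p(x) = (x / p^{v_p(x)}) mod p` has no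
  monochromatic positive solution (we divide the relation by `p^{min v_p(x_i)}` instead of
  normalising `gcd(x_i) = 1`).
* `rado_single_equation` — **Theorem 4 (Rado's theorem — abridged)** as an `iff`.
* `schur`, `schur_of_card_le` — **Theorem 1 (Schur's theorem)** (p. 69) in the finite form used on
  p. 70, obtained here as the instance `x₁ + x₂ − x₃ = 0` of Theorem 4 (zero-sum subset `{1, −1}`)
  instead of from Ramsey's theorem.
* `schur_fermat_congruence` — Schur's original application (Historical Note, pp. 69–70): for every
  `m ≥ 1` and every sufficiently large prime `p`, `x^m + y^m = z^m` has a solution in `ℤ/p` with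
  `xyz ≠ 0` (colour `(ℤ/p)ˣ` by the `≤ m` cosets of the `m`-th powers).

Faithfulness note.  Theorem 4 is printed with "`c_i ∈ Z`"; the nonvanishing `c_i ≠ 0` (as in
Rado's theorem) is necessary for the "if" direction — `0·x₁ + x₂ + x₃ = 0` has the zero-sum subset
`{c₁}` and no solution in positive integers — and is stated here.  Not treated: §3.3 (the Columns
condition, Rado's theorem complete), §3.4–3.6.

## References

* [GrahamRothschildSpencer1990] R. L. Graham, B. L. Rothschild, J. H. Spencer, *Ramsey Theory*,
  2nd ed., Wiley (1990), Ch. 3 §§3.1–3.2, Theorems 1, 2, 4, Corollary 3 (held text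
  `book:graham1990-ramsey-theory`, chunks 65–68).
* [Rado1933] R. Rado, *Studien zur Kombinatorik*, Math. Z. 36 (1933) 424–480.
* [Schur1916] I. Schur, *Über die Kongruenz x^m + y^m ≡ z^m (mod p)*, Jahresber. Deutsch.
  Math.-Verein. 25 (1916) 114–117.
* [Lothaire1997] M. Lothaire, *Combinatorics on Words*, Theorem 3.1.3 (van der Waerden) — the tree
  file `Literature/Combinatorics/Words/VanDerWaerdenCadences.lean` imported here.
-/

namespace Literature.Combinatorics.Additive

open Finset

section StrengthenedVanDerWaerden

/-- **Theorem 2 relative to a set `T` of admissible colours** (the induction on the number `r`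
of colours in the printed proof, run on `#T`): for `k, s ≥ 1` and every `T` with `#T ≤ m` there
is `n ≥ 1` such that every colouring `χ` of `ℕ` whose values on `[1, n]` lie in `T` admits
`a, d > 0` with `a + kd ≤ n`, `sd ≤ n` and `{a, a + d, …, a + kd} ∪ {sd}` monochromatic.  Step:
take `L ≥ n(k, T ∖ {c₀}, s)` for all `c₀ ∈ T`, `W = W(kL + 1)` from van der Waerden's theorem and
`n = s(W + 1)`; a monochromatic (say red) progression `{a + i d' : 0 ≤ i ≤ kL}` either meets a red
`s d' j` (`1 ≤ j ≤ L`), giving `d = j d'`, or `{s d' j : 1 ≤ j ≤ L}` avoids red and the colouring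
`x ↦ χ(s d' x)` of `[1, L]` uses only `T ∖ {red}`.
[cite: GrahamRothschildSpencer1990, Ch. 3 §3.1, Theorem 2 (p. 70) and its proof] -/
theorem exists_mono_ap_with_multiple_of_colours_subset {κ : Type*} [Fintype κ] [DecidableEq κ]
    (k s : ℕ) (hk : 1 ≤ k) (hs : 1 ≤ s) :
    ∀ (m : ℕ) (T : Finset κ), T.card ≤ m → ∃ n : ℕ, 1 ≤ n ∧ ∀ χ : ℕ → κ,
      (∀ x, 1 ≤ x → x ≤ n → χ x ∈ T) →
      ∃ a d : ℕ, 0 < a ∧ 0 < d ∧ a + k * d ≤ n ∧ s * d ≤ n ∧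
        ∀ i ≤ k, χ (a + i * d) = χ (s * d) := by
  intro m
  induction m with
  | zero =>
    intro T hT
    refine ⟨1, le_rfl, fun χ hχ => ?_⟩
    have h1 := hχ 1 le_rfl le_rfl
    rw [Finset.card_eq_zero.mp (Nat.le_zero.mp hT)] at h1
    exact absurd h1 (Finset.notMem_empty _)
  | succ m ih =>
    intro T hT
    have ih' : ∀ c₀ ∈ T, ∃ n : ℕ, 1 ≤ n ∧ ∀ χ : ℕ → κ,
        (∀ x, 1 ≤ x → x ≤ n → χ x ∈ T.erase c₀) →
        ∃ a d : ℕ, 0 < a ∧ 0 < d ∧ a + k * d ≤ n ∧ s * d ≤ n ∧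
          ∀ i ≤ k, χ (a + i * d) = χ (s * d) :=
      fun c₀ hc₀ => ih (T.erase c₀) (by rw [Finset.card_erase_of_mem hc₀]; omega)
    choose! nf hnf1 hnf using ih'
    -- a common bound `L` for all the `n(k, T ∖ {c₀}, s)`
    set L : ℕ := T.sup nf with hL
    have hLe : ∀ c₀ ∈ T, nf c₀ ≤ L := fun c₀ hc₀ => Finset.le_sup (f := nf) hc₀
    obtain ⟨W, hW⟩ := Literature.Combinatorics.Words.vanDerWaerden κ (k * L + 1)
    have hsW : W + 1 ≤ s * (W + 1) := Nat.le_mul_of_pos_left _ hs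
    refine ⟨s * (W + 1), le_trans (by omega) hsW, fun χ hχ => ?_⟩
    obtain ⟨a', d', hd', hbd, hmono⟩ := hW (fun x => χ (x + 1))
    simp only [Nat.add_sub_cancel] at hbd
    -- the red progression `a, a + d', …, a + kL d'` with `a = a' + 1 ≥ 1`
    have hmono' : ∀ i ≤ k * L, χ (a' + 1 + i * d') = χ (a' + 1) := by
      intro i hi
      rw [add_right_comm]
      exact hmono i (Nat.lt_succ_of_le hi)
    have hLd : L * d' ≤ W := by
      have h1 : L * d' ≤ k * (L * d') := Nat.le_mul_of_pos_left _ hk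
      rw [← mul_assoc] at h1
      omega
    have hred : χ (a' + 1) ∈ T := hχ _ (by omega) (by omega)
    by_cases hj : ∃ j, 1 ≤ j ∧ j ≤ L ∧ χ (s * (j * d')) = χ (a' + 1)
    · -- Case 1: some `s d' j` is red
      obtain ⟨j, hj1, hjL, hjc⟩ := hj
      have hjd : j * d' ≤ L * d' := Nat.mul_le_mul_right _ hjL
      refine ⟨a' + 1, j * d', by omega, Nat.mul_pos (by omega) hd', ?_, ?_, fun i hi => ?_⟩
      · have : k * (j * d') ≤ k * (L * d') := Nat.mul_le_mul_left _ hjd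
        rw [← mul_assoc k L d'] at this
        omega
      · have : s * (j * d') ≤ s * (W + 1) := Nat.mul_le_mul_left _ (by omega)
        exact this
      · rw [hjc, show a' + 1 + i * (j * d') = a' + 1 + i * j * d' by ring]
        exact hmono' (i * j) (Nat.mul_le_mul hi hjL)
    · -- Case 2: `{s d' j : 1 ≤ j ≤ L}` avoids red: recolour `[1, L]` by `x ↦ χ (s d' x)`
      push Not at hj
      obtain ⟨a₂, d₂, ha₂, hd₂, hbd₂, hsd₂, hmono₂⟩ :=
        hnf (χ (a' + 1)) hred (fun x => χ (s * (x * d'))) (by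
          intro x hx1 hx2
          have hxL : x ≤ L := le_trans hx2 (hLe _ hred)
          refine Finset.mem_erase.mpr ⟨hj x hx1 hxL, hχ _ ?_ ?_⟩
          · exact Nat.mul_pos (by omega) (Nat.mul_pos (by omega) hd')
          · have h1 : x * d' ≤ L * d' := Nat.mul_le_mul_right _ hxL
            have h2 : s * (x * d') ≤ s * (W + 1) := Nat.mul_le_mul_left _ (by omega)
            exact h2)
      have hn2 : nf (χ (a' + 1)) * d' ≤ W :=
        le_trans (Nat.mul_le_mul_right _ (hLe _ hred)) hLd
      refine ⟨s * (a₂ * d'), s * (d₂ * d'), Nat.mul_pos (by omega) (Nat.mul_pos ha₂ hd'),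
        Nat.mul_pos (by omega) (Nat.mul_pos hd₂ hd'), ?_, ?_, fun i hi => ?_⟩
      · rw [show s * (a₂ * d') + k * (s * (d₂ * d')) = s * ((a₂ + k * d₂) * d') by ring]
        have h1 : (a₂ + k * d₂) * d' ≤ nf (χ (a' + 1)) * d' := Nat.mul_le_mul_right _ hbd₂
        have h2 : s * ((a₂ + k * d₂) * d') ≤ s * (W + 1) := Nat.mul_le_mul_left _ (by omega)
        exact h2
      · rw [show s * (s * (d₂ * d')) = s * ((s * d₂) * d') by ring]
        have h1 : (s * d₂) * d' ≤ nf (χ (a' + 1)) * d' := Nat.mul_le_mul_right _ hsd₂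
        exact Nat.mul_le_mul_left _ (by omega)
      · rw [show s * (a₂ * d') + i * (s * (d₂ * d')) = s * ((a₂ + i * d₂) * d') by ring,
          show s * (s * (d₂ * d')) = s * ((s * d₂) * d') by ring]
        exact hmono₂ i hi

/-- **Theorem 2** (a common strengthening of Schur's and van der Waerden's theorems): for all
`k` and `s ≥ 1` and every finite set of colours there is `n` such that every colouring of `ℕ`
has `a, d > 0` with `a + kd ≤ n`, `sd ≤ n` and `{a, a + d, …, a + kd} ∪ {sd}` monochromatic
(the text takes `k ≥ 1`; `k = 0` is trivial).
[cite: GrahamRothschildSpencer1990, Ch. 3 §3.1, Theorem 2 (p. 70)] -/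
theorem exists_mono_ap_with_multiple (κ : Type*) [Finite κ] (k s : ℕ) (hs : 1 ≤ s) :
    ∃ n : ℕ, ∀ χ : ℕ → κ, ∃ a d : ℕ, 0 < a ∧ 0 < d ∧ a + k * d ≤ n ∧ s * d ≤ n ∧
      ∀ i ≤ k, χ (a + i * d) = χ (s * d) := by
  classical
  rcases Nat.eq_zero_or_pos k with rfl | hk
  · refine ⟨s, fun χ => ⟨s, 1, hs, one_pos, by simp, by simp, fun i hi => ?_⟩⟩
    simp [Nat.le_zero.mp hi]
  haveI := Fintype.ofFinite κ
  obtain ⟨n, -, hn⟩ := exists_mono_ap_with_multiple_of_colours_subset k s hk hs _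
    (Finset.univ : Finset κ) le_rfl
  exact ⟨n, fun χ => hn χ fun x _ _ => Finset.mem_univ _⟩

/-- **Corollary 3** (symmetric form): for all `k`, `s ≥ 1` and every finite set of colours
there is `n` such that every colouring of `ℕ` has `a, d` with `d > 0`, `kd < a`, `a + kd ≤ n`,
`sd ≤ n` and `{a + λd : |λ| ≤ k} ∪ {sd}` monochromatic (apply Theorem 2 with `2k` and recentre
at `a' + kd'`). [cite: GrahamRothschildSpencer1990, Ch. 3 §3.1, Corollary 3 (p. 71)] -/
theorem exists_mono_symmetric_ap_with_multiple (κ : Type*) [Finite κ] (k s : ℕ) (hs : 1 ≤ s) :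
    ∃ n : ℕ, ∀ χ : ℕ → κ, ∃ a d : ℕ, k * d < a ∧ 0 < d ∧ a + k * d ≤ n ∧ s * d ≤ n ∧
      (∀ i ≤ k, χ (a + i * d) = χ (s * d)) ∧ ∀ i ≤ k, χ (a - i * d) = χ (s * d) := by
  obtain ⟨n, hn⟩ := exists_mono_ap_with_multiple κ (2 * k) s hs
  refine ⟨n, fun χ => ?_⟩
  obtain ⟨a, d, ha, hd, hbd, hsd, hmono⟩ := hn χ
  rw [mul_assoc] at hbd
  refine ⟨a + k * d, d, by omega, hd, by omega, hsd, fun i hi => ?_, fun i hi => ?_⟩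
  · rw [show a + k * d + i * d = a + (k + i) * d by ring]
    exact hmono (k + i) (by omega)
  · have h1 : i * d ≤ k * d := Nat.mul_le_mul_right _ hi
    rw [Nat.add_sub_assoc h1, ← Nat.sub_mul]
    exact hmono (k - i) (by omega)

end StrengthenedVanDerWaerden

section Rado

/-- **Theorem 4 (Rado's theorem for a single equation), the "if" direction, finite form**: if the
nonzero integers `c_i` have a nonempty subset `J` summing to zero, then for every finite set of
colours there is `N` such that every colouring of `ℕ` has a monochromatic solution of
`Σ c_i x_i = 0` in positive integers `x_i ≤ N`.  Proof as printed: with `B = Σ_{i ∉ J} c_i`, if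
`B = 0` take all `x_i = 1`; otherwise fix `i₀ ∈ J` and use the parametric solution `x_i = a`
(`i ∈ J ∖ {i₀}`), `x_{i₀} = a + λd`, `x_i = sd` (`i ∉ J`) with `λ = −B c_{i₀}`, `s = c_{i₀}²`
(a choice of the printed `λ_i, s, t` needing no Bézout coefficients), made monochromatic by
Corollary 3. [cite: GrahamRothschildSpencer1990, Ch. 3 §3.2, Theorem 4 (p. 71), "if" part;
Rado1933] -/
theorem rado_of_subset_sum_eq_zero {ι : Type*} [Fintype ι] [DecidableEq ι] (c : ι → ℤ)
    (hc : ∀ i, c i ≠ 0) {J : Finset ι} (hJ : J.Nonempty) (hJ0 : ∑ i ∈ J, c i = 0)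
    (κ : Type*) [Finite κ] :
    ∃ N : ℕ, ∀ χ : ℕ → κ, ∃ x : ι → ℕ, (∀ i, 0 < x i ∧ x i ≤ N) ∧ (∀ i j, χ (x i) = χ (x j)) ∧
      ∑ i, c i * (x i : ℤ) = 0 := by
  classical
  obtain ⟨i₀, hi₀⟩ := hJ
  set B : ℤ := ∑ i ∈ univ \ J, c i with hB
  have hsplit : ∀ y : ι → ℤ,
      ∑ i, c i * y i = ∑ i ∈ J, c i * y i + ∑ i ∈ univ \ J, c i * y i := by
    intro y
    rw [← Finset.sum_union disjoint_sdiff, Finset.union_sdiff_of_subset (Finset.subset_univ J)]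
  by_cases hB0 : B = 0
  · refine ⟨1, fun χ => ⟨fun _ => 1, fun _ => ⟨one_pos, le_rfl⟩, fun _ _ => rfl, ?_⟩⟩
    have h := hsplit fun _ => 1
    simp only [Nat.cast_one, mul_one] at h ⊢
    rw [h, hJ0, ← hB, hB0, add_zero]
  -- `B ≠ 0`: the parametric solution
  set l : ℤ := -B * c i₀ with hl
  set K : ℕ := l.natAbs with hK
  set s : ℕ := (c i₀).natAbs ^ 2 with hs
  have hs1 : 1 ≤ s := Nat.one_le_pow _ _ (Int.natAbs_pos.mpr (hc i₀))
  have hsc : (s : ℤ) = c i₀ ^ 2 := by rw [hs]; push_cast; exact sq_abs _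
  obtain ⟨n, hn⟩ := exists_mono_symmetric_ap_with_multiple κ K s hs1
  refine ⟨n, fun χ => ?_⟩
  obtain ⟨a, d, hKd, hd, hbd, hsd, hplus, hminus⟩ := hn χ
  -- the exceptional coordinate `x_{i₀} = a + λ d`, as a natural number
  set x₀ : ℕ := if 0 ≤ l then a + K * d else a - K * d with hx₀
  have hx₀int : (x₀ : ℤ) = a + l * d := by
    rcases le_or_gt 0 l with h | h
    · rw [hx₀, if_pos h]; push_cast; rw [hK, Int.natAbs_of_nonneg h]
    · rw [hx₀, if_neg (not_le.mpr h), Nat.cast_sub hKd.le]; push_cast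
      rw [hK, Int.ofNat_natAbs_of_nonpos h.le]; ring
  have hx₀col : χ x₀ = χ (s * d) := by
    rcases le_or_gt 0 l with h | h
    · rw [hx₀, if_pos h]; exact hplus K le_rfl
    · rw [hx₀, if_neg (not_le.mpr h)]; exact hminus K le_rfl
  have hx₀pos : 0 < x₀ := by
    rcases le_or_gt 0 l with h | h
    · rw [hx₀, if_pos h]; omega
    · rw [hx₀, if_neg (not_le.mpr h)]; omega
  have hx₀le : x₀ ≤ n := by
    rcases le_or_gt 0 l with h | h
    · rw [hx₀, if_pos h]; exact hbd
    · rw [hx₀, if_neg (not_le.mpr h)]; omega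
  refine ⟨fun i => if i ∈ J then (if i = i₀ then x₀ else a) else s * d, fun i => ?_,
    fun i j => ?_, ?_⟩
  · by_cases hiJ : i ∈ J
    · by_cases hii : i = i₀
      · simp only [hii, hi₀, if_true]; exact ⟨hx₀pos, hx₀le⟩
      · simp only [hiJ, hii, if_true, if_false]; exact ⟨by omega, by omega⟩
    · simp only [hiJ, if_false]; exact ⟨Nat.mul_pos (by omega) hd, hsd⟩
  · -- every coordinate has the colour of `s d`
    have hcol : ∀ i, χ (if i ∈ J then (if i = i₀ then x₀ else a) else s * d) = χ (s * d) := by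
      intro i
      by_cases hiJ : i ∈ J
      · by_cases hii : i = i₀
        · simp only [hii, hi₀, if_true]; exact hx₀col
        · simp only [hiJ, hii, if_true, if_false]
          simpa using hplus 0 (Nat.zero_le _)
      · simp only [hiJ, if_false]
    rw [hcol i, hcol j]
  · -- the equation
    rw [hsplit]
    have hJsum : ∑ i ∈ J, c i * ((if i ∈ J then (if i = i₀ then x₀ else a) else s * d : ℕ) : ℤ)
        = ∑ i ∈ J, (c i * a + (if i = i₀ then c i₀ * (l * d) else 0)) := by
      refine Finset.sum_congr rfl fun i hi => ?_
      by_cases hii : i = i₀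
      · subst hii; simp only [hi, if_true, hx₀int]; ring
      · simp only [hi, hii, if_true, if_false]
        ring
    have hJ'sum : ∑ i ∈ univ \ J, c i * ((if i ∈ J then (if i = i₀ then x₀ else a) else s * d : ℕ) : ℤ)
        = ∑ i ∈ univ \ J, c i * ((s : ℤ) * d) := by
      refine Finset.sum_congr rfl fun i hi => ?_
      have hiJ : i ∉ J := (Finset.mem_sdiff.mp hi).2
      simp only [hiJ, if_false]; push_cast; ring
    rw [hJsum, hJ'sum, Finset.sum_add_distrib, Finset.sum_ite_eq' J i₀, if_pos hi₀,
      ← Finset.sum_mul, hJ0, zero_mul, zero_add, ← Finset.sum_mul, ← hB, hsc, hl]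
    ring

/-- **Theorem 4, the "only if" direction (the super-modulo-`p` colouring)**: if no nonempty subset
of the integers `c_i` (at least one variable) sums to zero, then for every prime `p` exceeding
`Σ |c_i|` the colouring `F_p(x) = (x / p^{v_p(x)}) mod p` of the positive integers admits no
monochromatic solution of `Σ c_i x_i = 0`.  Printed proof (with the division by `p^{min v_p(x_i)}`
in place of the normalisation `gcd(x_1, …, x_n) = 1`): reducing modulo `p`, the indices of minimal
`p`-adic valuation form a nonempty set `J` with `(Σ_{i ∈ J} c_i) · u ≡ 0 (mod p)` for the common
colour `u ≢ 0`, so `p ∣ Σ_{i ∈ J} c_i`, `0 < |Σ_{i ∈ J} c_i| < p`.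
[cite: GrahamRothschildSpencer1990, Ch. 3 §3.2, Theorem 4 (pp. 71–73), Claim; Rado1933] -/
theorem no_mono_solution_smod_colouring {ι : Type*} [Fintype ι] [Nonempty ι] (c : ι → ℤ)
    (h : ∀ J : Finset ι, J.Nonempty → ∑ i ∈ J, c i ≠ 0) {p : ℕ} (hp : p.Prime)
    (hpc : ∑ i, (c i).natAbs < p) (x : ι → ℕ) (hx : ∀ i, 0 < x i)
    (hmono : ∀ i j, ((x i / p ^ (x i).factorization p : ℕ) : ZMod p) =
      ((x j / p ^ (x j).factorization p : ℕ) : ZMod p)) :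
    ∑ i, c i * (x i : ℤ) ≠ 0 := by
  classical
  intro hsum
  haveI := Fact.mk hp
  obtain ⟨e, he⟩ : ∃ e : ι → ℕ, ∀ i, e i = (x i).factorization p := ⟨_, fun _ => rfl⟩
  obtain ⟨m, hm⟩ : ∃ m : ι → ℕ, ∀ i, m i = x i / p ^ e i := ⟨_, fun _ => rfl⟩
  have hxm : ∀ i, x i = p ^ e i * m i := fun i => by
    rw [hm, he]; exact (Nat.ordProj_mul_ordCompl_eq_self (x i) p).symm
  have hpm : ∀ i, ¬ p ∣ m i := fun i => by
    rw [hm, he]; exact Nat.not_dvd_ordCompl hp (hx i).ne'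
  have hmono' : ∀ i j, (m i : ZMod p) = m j := fun i j => by
    rw [hm, hm, he, he]; exact hmono i j
  -- an index of minimal `p`-adic valuation and the set `J` of all such indices
  obtain ⟨i₁, -, hi₁⟩ := Finset.exists_min_image Finset.univ e Finset.univ_nonempty
  set J : Finset ι := Finset.univ.filter (fun i => e i = e i₁) with hJ
  have hJne : J.Nonempty := ⟨i₁, by simp [hJ]⟩
  -- divide the relation by `p ^ e i₁`
  have hsum' : ∑ i, c i * (p : ℤ) ^ (e i - e i₁) * (m i : ℤ) = 0 := by
    have key : (p : ℤ) ^ e i₁ * ∑ i, c i * (p : ℤ) ^ (e i - e i₁) * (m i : ℤ) =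
        ∑ i, c i * (x i : ℤ) := by
      rw [Finset.mul_sum]
      refine Finset.sum_congr rfl fun i _ => ?_
      rw [hxm i]; push_cast
      rw [← Nat.add_sub_cancel' (hi₁ i (Finset.mem_univ _)), pow_add, Nat.add_sub_cancel_left]
      ring
    rw [hsum] at key
    exact (mul_eq_zero.mp key).resolve_left (pow_ne_zero _ (by exact_mod_cast hp.ne_zero))
  -- reduce modulo `p`
  have hz : ((∑ i, c i * (p : ℤ) ^ (e i - e i₁) * (m i : ℤ) : ℤ) : ZMod p) = 0 := by
    rw [hsum', Int.cast_zero]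
  push_cast at hz
  have h1 : ∀ i ∈ J, (c i : ZMod p) * (p : ZMod p) ^ (e i - e i₁) * (m i : ZMod p) =
      (c i : ZMod p) * (m i₁ : ZMod p) := by
    intro i hi
    rw [hJ, Finset.mem_filter] at hi
    rw [hi.2, Nat.sub_self, pow_zero, mul_one, hmono' i i₁]
  have h2 : ∀ i ∈ Finset.univ.filter (fun i => ¬ e i = e i₁),
      (c i : ZMod p) * (p : ZMod p) ^ (e i - e i₁) * (m i : ZMod p) = 0 := by
    intro i hi
    rw [Finset.mem_filter] at hi
    have hlt : e i₁ < e i := lt_of_le_of_ne (hi₁ i (Finset.mem_univ _)) (Ne.symm hi.2)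
    rw [ZMod.natCast_self, zero_pow (Nat.sub_ne_zero_of_lt hlt), mul_zero, zero_mul]
  rw [← Finset.sum_filter_add_sum_filter_not Finset.univ (fun i => e i = e i₁),
    Finset.sum_congr rfl h1, Finset.sum_congr rfl h2, Finset.sum_const_zero, add_zero,
    ← Finset.sum_mul] at hz
  have hu : (m i₁ : ZMod p) ≠ 0 := fun h0 => hpm i₁ ((ZMod.natCast_eq_zero_iff _ _).mp h0)
  have hJz : ((∑ i ∈ J, c i : ℤ) : ZMod p) = 0 := by
    push_cast; exact (mul_eq_zero.mp hz).resolve_right hu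
  have hdvd : (p : ℤ) ∣ ∑ i ∈ J, c i := (ZMod.intCast_zmod_eq_zero_iff_dvd _ _).mp hJz
  have hlt : (∑ i ∈ J, c i).natAbs < (p : ℤ).natAbs := by
    rw [Int.natAbs_natCast]
    refine lt_of_le_of_lt ((Int.natAbs_sum_le _ _).trans ?_) hpc
    exact Finset.sum_le_sum_of_subset_of_nonneg (Finset.subset_univ J) fun _ _ _ => Nat.zero_le _
  exact h J hJne (Int.eq_zero_of_dvd_of_natAbs_lt_natAbs hdvd hlt)

/-- **Theorem 4 (Rado's theorem — abridged; Rado 1933)**: for nonzero integers `c_i` (at least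
one), the equation `Σ c_i x_i = 0` is regular on the positive integers — every finite colouring
has a monochromatic solution in positive integers — iff some nonempty subset of the `c_i` sums
to zero.  (The text states `c_i ∈ ℤ`; nonvanishing, as in Rado's theorem, is needed:
`0·x₁ + x₂ + x₃ = 0` has the zero-sum subset `{c₁}` and no positive solution.)
[cite: GrahamRothschildSpencer1990, Ch. 3 §3.2, Theorem 4 (p. 71); Rado1933] -/
theorem rado_single_equation {ι : Type*} [Fintype ι] [Nonempty ι] (c : ι → ℤ)
    (hc : ∀ i, c i ≠ 0) :
    (∃ J : Finset ι, J.Nonempty ∧ ∑ i ∈ J, c i = 0) ↔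
      ∀ (κ : Type) [Finite κ] (χ : ℕ → κ), ∃ x : ι → ℕ, (∀ i, 0 < x i) ∧
        (∀ i j, χ (x i) = χ (x j)) ∧ ∑ i, c i * (x i : ℤ) = 0 := by
  classical
  constructor
  · rintro ⟨J, hJ, hJ0⟩ κ _ χ
    obtain ⟨N, hN⟩ := rado_of_subset_sum_eq_zero c hc hJ hJ0 κ
    obtain ⟨x, hxb, hmono, hsum⟩ := hN χ
    exact ⟨x, fun i => (hxb i).1, hmono, hsum⟩
  · intro hreg
    by_contra hno
    push Not at hno
    obtain ⟨p, hpS, hp⟩ := Nat.exists_infinite_primes (∑ i, (c i).natAbs + 1)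
    haveI : NeZero p := ⟨hp.ne_zero⟩
    obtain ⟨x, hx, hmono, hsum⟩ :=
      hreg (ZMod p) (fun n : ℕ => ((n / p ^ n.factorization p : ℕ) : ZMod p))
    exact no_mono_solution_smod_colouring c (fun J hJ => hno J hJ) hp (by omega) x hx hmono hsum

end Rado

section Schur

/-- **Theorem 1 (Schur's theorem, 1916), finite form**: for every finite set of colours there is
`N` such that every colouring of `ℕ` has `x, y ≥ 1` with `x + y ≤ N` and `x, y, x + y` of the
same colour.  Obtained here as the instance `x₁ + x₂ − x₃ = 0` (zero-sum subset `{1, −1}`) of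
Rado's theorem rather than from Ramsey's theorem as in the printed proof.
[cite: GrahamRothschildSpencer1990, Ch. 3 §3.1, Theorem 1 (p. 69); Schur1916] -/
theorem schur (κ : Type*) [Finite κ] :
    ∃ N : ℕ, ∀ χ : ℕ → κ, ∃ x y : ℕ, 0 < x ∧ 0 < y ∧ x + y ≤ N ∧
      χ x = χ (x + y) ∧ χ y = χ (x + y) := by
  classical
  have hc : ∀ i : Fin 3, (![1, 1, -1] : Fin 3 → ℤ) i ≠ 0 := by
    intro i; fin_cases i <;> simp
  have hJ0 : ∑ i ∈ ({0, 2} : Finset (Fin 3)), (![1, 1, -1] : Fin 3 → ℤ) i = 0 := by decide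
  obtain ⟨N, hN⟩ := rado_of_subset_sum_eq_zero (![1, 1, -1] : Fin 3 → ℤ) hc
    (J := ({0, 2} : Finset (Fin 3))) (by simp) hJ0 κ
  refine ⟨N, fun χ => ?_⟩
  obtain ⟨x, hxb, hmono, hsum⟩ := hN χ
  rw [Fin.sum_univ_three] at hsum
  simp only [Matrix.cons_val_zero, Matrix.cons_val_one, Matrix.cons_val] at hsum
  have h2 : x 2 = x 0 + x 1 := by
    have : (x 2 : ℤ) = x 0 + x 1 := by linarith
    exact_mod_cast this
  refine ⟨x 0, x 1, (hxb 0).1, (hxb 1).1, h2 ▸ (hxb 2).2, ?_, ?_⟩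
  · rw [← h2]; exact hmono 0 2
  · rw [← h2]; exact hmono 1 2

/-- **Schur's theorem with a bound depending only on the number of colours**: for every `r`
there is `N = N(r)` that serves every set of at most `r` colours.
[cite: GrahamRothschildSpencer1990, Ch. 3 §3.1, Theorem 1 (p. 69) and the "finite form of
Schur's theorem" used on p. 70; Schur1916] -/
theorem schur_of_card_le (r : ℕ) :
    ∃ N : ℕ, ∀ (κ : Type*) [Fintype κ], Fintype.card κ ≤ r → ∀ χ : ℕ → κ,
      ∃ x y : ℕ, 0 < x ∧ 0 < y ∧ x + y ≤ N ∧ χ x = χ (x + y) ∧ χ y = χ (x + y) := by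
  obtain ⟨N, hN⟩ := schur (Fin r)
  refine ⟨N, fun κ _ hκ χ => ?_⟩
  have : Nonempty (κ ↪ Fin r) :=
    Function.Embedding.nonempty_iff_card_le.mpr (by simpa using hκ)
  obtain ⟨emb⟩ := this
  obtain ⟨x, y, hx, hy, hb, h1, h2⟩ := hN (emb ∘ χ)
  exact ⟨x, y, hx, hy, hb, emb.injective h1, emb.injective h2⟩

/-- **Schur's application to the Fermat congruence (1916)**: for every `m ≥ 1` and every
sufficiently large prime `p`, `x^m + y^m = z^m` has a solution in `ℤ/p` with `x, y, z ≠ 0`.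
Printed proof: the subgroup `H` of `m`-th powers of `(ℤ/p)ˣ` has index `gcd(m, p − 1) ≤ m`; colour
`{1, …, p − 1}` by the cosets of `H` (here: through an injection of `(ℤ/p)ˣ ⧸ H` into `Fin m`,
the index being `#ker(u ↦ u^m) ≤ m`); for `p > N(m)` Schur's theorem gives `a + b = c` of one
colour, whence `1 + a⁻¹b = a⁻¹c` with `1, a⁻¹b, a⁻¹c` nonzero `m`-th powers.
[cite: GrahamRothschildSpencer1990, Ch. 3 §3.1, Historical Note and Theorem (pp. 69–70);
Schur1916] -/
theorem schur_fermat_congruence (m : ℕ) (hm : 1 ≤ m) :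
    ∃ p₀ : ℕ, ∀ p : ℕ, p.Prime → p₀ < p →
      ∃ x y z : ZMod p, x ≠ 0 ∧ y ≠ 0 ∧ z ≠ 0 ∧ x ^ m + y ^ m = z ^ m := by
  classical
  obtain ⟨N, hN⟩ := schur_of_card_le.{0} m
  refine ⟨N, fun p hp hNp => ?_⟩
  haveI := Fact.mk hp
  -- the subgroup of `m`-th powers and the number of its cosets
  set φ : (ZMod p)ˣ →* (ZMod p)ˣ := powMonoidHom m with hφ
  set H : Subgroup (ZMod p)ˣ := φ.range with hH
  haveI : Fintype ((ZMod p)ˣ ⧸ H) := Fintype.ofFinite _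
  have hker : Nat.card φ.ker ≤ m := by
    rw [Nat.card_congr (Equiv.subtypeEquivRight (p := fun g => g ∈ φ.ker)
      (q := fun g : (ZMod p)ˣ => g ^ m = 1) (fun g => by rw [MonoidHom.mem_ker, hφ,
        powMonoidHom_apply])), Nat.card_eq_fintype_card, Fintype.card_subtype]
    exact IsCyclic.card_pow_eq_one_le hm
  have hcard : Fintype.card ((ZMod p)ˣ ⧸ H) ≤ m := by
    rw [Fintype.card_eq_nat_card, ← Subgroup.index_eq_card]
    have h1 : Nat.card H * H.index = Nat.card (ZMod p)ˣ := Subgroup.card_mul_index H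
    have h2 : Nat.card φ.ker * φ.ker.index = Nat.card (ZMod p)ˣ := Subgroup.card_mul_index _
    rw [Subgroup.index_ker, ← hH] at h2
    have hHpos : 0 < Nat.card H := Nat.card_pos
    have h3 : H.index = Nat.card φ.ker := by
      apply Nat.eq_of_mul_eq_mul_left hHpos
      rw [h1, ← h2, mul_comm]
    rw [h3]; exact hker
  have : Nonempty (((ZMod p)ˣ ⧸ H) ↪ Fin m) :=
    Function.Embedding.nonempty_iff_card_le.mpr (by simpa using hcard)
  obtain ⟨emb⟩ := this
  -- the coset colouring of `{1, …, p − 1}` (extended arbitrarily to multiples of `p`)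
  set χ : ℕ → Fin m := fun n =>
    if h : (n : ZMod p) = 0 then emb (1 : (ZMod p)ˣ ⧸ H)
    else emb (QuotientGroup.mk (Units.mk0 (n : ZMod p) h)) with hχ
  obtain ⟨x, y, hx, hy, hb, h1, h2⟩ := hN (Fin m) (by simp) χ
  have hx0 : (x : ZMod p) ≠ 0 := fun h0 =>
    Nat.not_dvd_of_pos_of_lt hx (by omega) ((ZMod.natCast_eq_zero_iff x p).mp h0)
  have hy0 : (y : ZMod p) ≠ 0 := fun h0 =>
    Nat.not_dvd_of_pos_of_lt hy (by omega) ((ZMod.natCast_eq_zero_iff y p).mp h0)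
  have hz0 : ((x + y : ℕ) : ZMod p) ≠ 0 := fun h0 =>
    Nat.not_dvd_of_pos_of_lt (by omega) (by omega) ((ZMod.natCast_eq_zero_iff (x + y) p).mp h0)
  have h1' : (QuotientGroup.mk (Units.mk0 (x : ZMod p) hx0) : (ZMod p)ˣ ⧸ H) =
      QuotientGroup.mk (Units.mk0 ((x + y : ℕ) : ZMod p) hz0) := by
    apply emb.injective
    have := h1
    simp only [hχ, dif_neg hx0, dif_neg hz0] at this
    exact this
  have h2' : (QuotientGroup.mk (Units.mk0 (y : ZMod p) hy0) : (ZMod p)ˣ ⧸ H) =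
      QuotientGroup.mk (Units.mk0 ((x + y : ℕ) : ZMod p) hz0) := by
    apply emb.injective
    have := h2
    simp only [hχ, dif_neg hy0, dif_neg hz0] at this
    exact this
  rw [QuotientGroup.eq, hH, MonoidHom.mem_range] at h1' h2'
  obtain ⟨w₂, hw₂⟩ := h1'
  obtain ⟨w₁, hw₁⟩ := h2'
  rw [hφ, powMonoidHom_apply] at hw₁ hw₂
  -- `x · w₂^m = x + y` and `y · w₁^m = x + y` in `ℤ/p`
  have hw₂' : (x : ZMod p) * (w₂ : ZMod p) ^ m = ((x + y : ℕ) : ZMod p) := by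
    have := congrArg (fun u : (ZMod p)ˣ => ((Units.mk0 (x : ZMod p) hx0 * u : (ZMod p)ˣ) : ZMod p)) hw₂
    simpa [mul_inv_cancel_left] using this
  have hw₁' : (y : ZMod p) * (w₁ : ZMod p) ^ m = ((x + y : ℕ) : ZMod p) := by
    have := congrArg (fun u : (ZMod p)ˣ => ((Units.mk0 (y : ZMod p) hy0 * u : (ZMod p)ˣ) : ZMod p)) hw₁
    simpa [mul_inv_cancel_left] using this
  -- `x = (x + y) (w₂⁻¹)^m`, `y = (x + y) (w₁⁻¹)^m`, so `(w₂⁻¹)^m + (w₁⁻¹)^m = 1 = 1^m`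
  refine ⟨((w₂⁻¹ : (ZMod p)ˣ) : ZMod p), ((w₁⁻¹ : (ZMod p)ˣ) : ZMod p), 1,
    Units.ne_zero _, Units.ne_zero _, one_ne_zero, ?_⟩
  apply mul_left_cancel₀ hz0
  rw [one_pow, mul_one, mul_add]
  nth_rw 1 [← hw₂']
  nth_rw 1 [← hw₁']
  rw [mul_assoc, ← mul_pow, mul_assoc (y : ZMod p), ← mul_pow, Units.mul_inv, Units.mul_inv,
    one_pow, mul_one, mul_one, Nat.cast_add]

end Schur

end Literature.Combinatorics.Additive
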